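import Summits.CriticalPhenomena.PercolationContinuityZ3.Theorems.SahiMasterFamilyCrossOrbitTriangle
import Summits.CriticalPhenomena.PercolationContinuityZ3.Theorems.SahiMasterFamilyTriangleOfGT
import HarnessLib

/-!
# Kahn/Sahi `C₃` for supports meeting in at most two coordinates — the consumer-facing corollary

Unit `prim-master-conj` (crux anchor stmt-CriticalPhenomena-4575, helper work), gen 38; memo
`run/shared/lean/prim/prim-l12/FROM-prim-master-conj-g38-TRIANGLE-RECURSION.md`.

One statement packaging gens 37–38: for increasing events `U₀, U₁, U₂` determined by coordinate sets `S, T, R` with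
`|S ∩ T| ≤ 2` and no coordinate common to all three (`Disjoint (S ∩ T) R`), Sahi's third functional of the product measure is
nonnegative, `E_3(μ_p; 1_{U₀}, 1_{U₁}, 1_{U₂}) ≥ 0`.  Cases: `S ∩ T = ∅` is gen 37's `MixedRectangle.sahiE_three_ind_nonneg_of_supports`
(empty index type: `TriangleOfGT.sahiE_three_eq_zero_of_isEmpty`); `|S ∩ T| ∈ {1, 2}` is `CrossOrbit.sahiE_three_ind_nonneg_of_supports₂'`
(the (Ψ₂) orbit-sum certificate).  HONEST FRAMING: a proved special case; Kahn's Conjecture 5 / Sahi's `C₃` remain OPEN. [this work]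
-/

noncomputable section

open scoped Classical

namespace Summit.CriticalPhenomena.PercolationContinuityZ3.Theorems

namespace CrossOrbit

open Finset Function
open Literature.Combinatorics.Sahi2008
open Literature.Probability.Percolation (DeterminedBy)
open Literature.Probability.Percolation.DecisionTree (ind)

variable {ι : Type} [Fintype ι]

/-- **`C₃` when the supports of `U₀, U₁` meet in at most two coordinates and no coordinate is common to all three supports.**
For increasing `U₀, U₁, U₂` determined by `S, T, R` with `(S ∩ T).card ≤ 2` and `Disjoint (S ∩ T) R`:
`0 ≤ E_3(μ_p; 1_{U₀}, 1_{U₁}, 1_{U₂})`. [this work] -/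
theorem sahiE_three_ind_nonneg_of_card_inter_le_two (p : ι → unitInterval) {U : Fin 3 → Set (Set ι)}
    (hU : ∀ j, IsUpperSet (U j)) {S T R : Finset ι} (hS : DeterminedBy (U 0) (↑S : Set ι))
    (hT : DeterminedBy (U 1) (↑T : Set ι)) (hR : DeterminedBy (U 2) (↑R : Set ι))
    (hcard : (S ∩ T).card ≤ 2) (hdis : Disjoint (S ∩ T) R) :
    0 ≤ sahiE (bernoulliWeight p) 3 (fun j => ind (U j)) := by
  have hcases : (S ∩ T).card = 0 ∨ (S ∩ T).card = 1 ∨ (S ∩ T).card = 2 := by omega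
  rcases hcases with h0 | h1 | h2
  · have hST : S ∩ T = ∅ := Finset.card_eq_zero.1 h0
    rcases isEmpty_or_nonempty ι with hι | ⟨⟨e⟩⟩
    · exact (TriangleOfGT.sahiE_three_eq_zero_of_isEmpty p _).ge
    · exact MixedRectangle.sahiE_three_ind_nonneg_of_supports p e hU hS hT (hST ▸ Finset.empty_subset _)
  · obtain ⟨e, he⟩ := Finset.card_eq_one.1 h1
    have heST : e ∈ S ∩ T := he ▸ Finset.mem_singleton_self e
    have heR : e ∉ R := fun h => Finset.disjoint_left.1 hdis heST h
    exact sahiE_three_ind_nonneg_of_supports₂' p e e hU hS hT hR (by rw [he]; exact Finset.subset_insert _ _) heR heR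
  · obtain ⟨e, e', -, he⟩ := Finset.card_eq_two.1 h2
    have heST : e ∈ S ∩ T := he ▸ Finset.mem_insert_self e {e'}
    have he'ST : e' ∈ S ∩ T := he ▸ Finset.mem_insert_of_mem (Finset.mem_singleton_self e')
    exact sahiE_three_ind_nonneg_of_supports₂' p e e' hU hS hT hR he.le
      (fun h => Finset.disjoint_left.1 hdis heST h) (fun h => Finset.disjoint_left.1 hdis he'ST h)

end CrossOrbit

end Summit.CriticalPhenomena.PercolationContinuityZ3.Theorems
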